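import Mathlib
import Summits.CriticalPhenomena.PercolationContinuityZ3.Theorems.PercNearOneGluingNoHeavyLowerTailSigmaCM
import HarnessLib

/-!
# LEMMA Q: products `∏_{m≤r} τ_m` with `1/τ − 1` completely monotone are Hausdorff moment sequences; `c_n/n` CM ⟹ TN on the whole ray

Support file for the Sahi / Conjecture-P programme of route `PercNearOneGluingNoHeavy`
(`--supports stmt-CriticalPhenomena-4575`, prover prim-l12-p5 gen 42; proof note
`prim-l12-p5/PROOF-TN-ALL-RAYS-g42.md` §1).  No definitions, no named facts, no sorries.

Hausdorff differences `D_k h (j) = Σ_{i≤k} (-1)^i C(k,i) h(j+i)` are written out; sequences indexed by `m ≥ 1` are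
passed as `m ↦ h (m+1)` (conventions of `…LowerTailSigmaCM`).

g36's LEMMA P (`altSum_prod_nonneg`): `0 < τ_m ≤ 1` and `m ↦ 1 − τ_m` completely monotone ⟹ `μ_r := ∏_{m≤r} τ_m` completely
monotone, via `μ_r − μ_{r+1} = μ_r·(1 − τ_{r+1})`.  Writing the same difference through the NEXT term,
`μ_r − μ_{r+1} = μ_{r+1}·(1/τ_{r+1} − 1)`, gives a twin lemma with the hypothesis on `φ_m := 1/τ_m − 1` instead:

* **LEMMA Q** (`altSum_prod_nonneg_of_inv`, strict form `altSum_prod_pos_of_inv`): if `0 < τ_m` (`m ≥ 1`) and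
  `m ↦ 1/τ_m − 1` is completely monotone then `r ↦ ∏_{m≤r} τ_m` is completely monotone — strictly if all `τ_m < 1`.
  LEMMA P is the weaker statement: `σ := 1 − τ` CM ⟹ `1/τ − 1 = σ/(1−σ) = Σ_{k≥1} σ^k` CM, not conversely
  (`τ_m = (1−y^m)/(1+εy^m)`, `ε` large).
* **`c_n/n` CM ⟹ TN** (`lPlusC_div_factorial_tn_of_inv_odds`): with THEOREM W♯(⟸) (`lPlusC_div_factorial_tn`,
  `μ_r = r!/∏_{m≤r}(m + c_m) = ∏ τ_m`, `τ_m = m/(m+c_m)`, `1/τ_m − 1 = c_m/m`): if `c_n > 0` and `n ↦ c_n/n` (`n ≥ 1`) is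
  completely monotone then `[(l + c_n)/(n−l)!]_{l≤n}` is totally nonnegative.  This class of `c` is a CONVEX CONE, so the
  whole ray is TN (`lPlusC_div_factorial_tn_of_inv_odds_ray`: `[(l + λc_n)/(n−l)!]` TN for every `λ > 0`) — g36's SCALING
  LEMMA needed the odds `n/c_n` to be discrete Bernstein, which implies `c_n/n` CM (LEMMA DB) but fails for the pure grabber
  below the line `θ + γ = 1`; `c_n/n` CM holds there (THEOREM X / THEOREM RII), see `…LowerTailTNAllRays`.
-/

namespace Summit.CriticalPhenomena.PercolationContinuityZ3.Theorems

namespace MomentRatioTN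

open Finset
open scoped Nat

/-! ### LEMMA Q -/

/-- The difference of consecutive partial products written through the NEXT product:
`τ_1⋯τ_r − τ_1⋯τ_{r+1} = (τ_1⋯τ_{r+1})·(1/τ_{r+1} − 1)`. -/
theorem prod_sub_prod_succ_eq (τ : ℕ → ℝ) (hτ : ∀ m, 0 < τ (m + 1)) (r : ℕ) :
    ∏ m ∈ range r, τ (m + 1) - ∏ m ∈ range (r + 1), τ (m + 1) =
      (∏ m ∈ range (r + 1), τ (m + 1)) * ((τ (r + 1))⁻¹ - 1) := by
  rw [prod_range_succ]
  have h := (hτ r).ne'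
  field_simp

/-- **LEMMA Q.**  Let `τ : ℕ → ℝ` with `0 < τ (m+1)` and suppose `m ↦ (τ (m+1))⁻¹ - 1` is completely monotone.  Then
`r ↦ ∏_{m<r} τ (m+1) = τ_1 ⋯ τ_r` is completely monotone.  (Proof: `μ_r − μ_{r+1} = μ_{r+1}(1/τ_{r+1} − 1)`, the shift
`r ↦ μ_{r+1}` is completely monotone up to the previous order, truncated Leibniz, induction on the order.) -/
theorem altSum_prod_nonneg_of_inv (τ : ℕ → ℝ) (hτ : ∀ m, 0 < τ (m + 1))
    (hφ : ∀ k j, 0 ≤ ∑ i ∈ range (k + 1), (-1 : ℝ) ^ i * (k.choose i : ℝ) * ((τ (j + i + 1))⁻¹ - 1))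
    (k j : ℕ) : 0 ≤ ∑ i ∈ range (k + 1), (-1 : ℝ) ^ i * (k.choose i : ℝ) * ∏ m ∈ range (j + i), τ (m + 1) := by
  suffices hK : ∀ K, ∀ k ≤ K, ∀ j,
      0 ≤ ∑ i ∈ range (k + 1), (-1 : ℝ) ^ i * (k.choose i : ℝ) * ∏ m ∈ range (j + i), τ (m + 1) from hK k k le_rfl j
  intro K
  induction K with
  | zero =>
    intro k hk j
    obtain rfl : k = 0 := Nat.le_zero.1 hk
    simpa using (prod_pos fun m _ => hτ m).le
  | succ K ih =>
    intro k hk j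
    rcases Nat.lt_or_ge k (K + 1) with hlt | hge
    · exact ih k (by omega) j
    obtain rfl : k = K + 1 := le_antisymm hk hge
    have hs := altSum_succ (fun r => ∏ m ∈ range r, τ (m + 1)) K j
    rw [show K + 1 + 1 = K + 2 from rfl, hs]
    simp_rw [prod_sub_prod_succ_eq τ hτ]
    refine altSum_mul_nonneg_upto (fun r => ∏ m ∈ range (r + 1), τ (m + 1)) (fun r => (τ (r + 1))⁻¹ - 1) K
      (fun k' hk' j' => ?_) (fun k' _ j' => hφ k' j') K le_rfl j
    -- the shifted partial products: D_k' μ(·+1) (j') = D_k' μ (j'+1)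
    refine le_of_le_of_eq (ih k' hk' (j' + 1)) (sum_congr rfl fun i _ => ?_)
    rw [show j' + 1 + i = j' + i + 1 by ring]

/-- **LEMMA Q, strict form.**  If moreover `τ (m+1) < 1` for all `m` (so `1/τ − 1 > 0`), the product sequence is STRICTLY
completely monotone. -/
theorem altSum_prod_pos_of_inv (τ : ℕ → ℝ) (hτ : ∀ m, 0 < τ (m + 1)) (hτ1 : ∀ m, τ (m + 1) < 1)
    (hφ : ∀ k j, 0 ≤ ∑ i ∈ range (k + 1), (-1 : ℝ) ^ i * (k.choose i : ℝ) * ((τ (j + i + 1))⁻¹ - 1))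
    (k j : ℕ) : 0 < ∑ i ∈ range (k + 1), (-1 : ℝ) ^ i * (k.choose i : ℝ) * ∏ m ∈ range (j + i), τ (m + 1) := by
  suffices hK : ∀ K, ∀ k ≤ K, ∀ j,
      0 < ∑ i ∈ range (k + 1), (-1 : ℝ) ^ i * (k.choose i : ℝ) * ∏ m ∈ range (j + i), τ (m + 1) from hK k k le_rfl j
  have hφpos : ∀ r, 0 < (τ (r + 1))⁻¹ - 1 := by
    intro r
    have h := hτ r
    have h1 := hτ1 r
    have e : (τ (r + 1))⁻¹ - 1 = (1 - τ (r + 1)) / τ (r + 1) := by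
      field_simp
    rw [e]
    exact div_pos (by linarith) h
  intro K
  induction K with
  | zero =>
    intro k hk j
    obtain rfl : k = 0 := Nat.le_zero.1 hk
    simpa using prod_pos fun m _ => hτ m
  | succ K ih =>
    intro k hk j
    rcases Nat.lt_or_ge k (K + 1) with hlt | hge
    · exact ih k (by omega) j
    obtain rfl : k = K + 1 := le_antisymm hk hge
    have hs := altSum_succ (fun r => ∏ m ∈ range r, τ (m + 1)) K j
    rw [show K + 1 + 1 = K + 2 from rfl, hs]
    simp_rw [prod_sub_prod_succ_eq τ hτ]
    have comm : ∀ r, (∏ m ∈ range (r + 1), τ (m + 1)) * ((τ (r + 1))⁻¹ - 1) =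
        ((τ (r + 1))⁻¹ - 1) * ∏ m ∈ range (r + 1), τ (m + 1) := fun r => mul_comm _ _
    simp_rw [comm]
    refine altSum_mul_pos_of_pos_upto (fun r => (τ (r + 1))⁻¹ - 1) (fun r => ∏ m ∈ range (r + 1), τ (m + 1)) K
      hφpos (fun k' _ j' => hφ k' j') (fun k' hk' j' => ?_) j
    refine lt_of_lt_of_eq (ih k' hk' (j' + 1)) (sum_congr rfl fun i _ => ?_)
    rw [show j' + 1 + i = j' + i + 1 by ring]

/-! ### `c_n/n` completely monotone ⟹ `[(l + c_n)/(n−l)!]` totally nonnegative, on the whole ray -/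

/-- **`c_n/n` CM ⟹ TN.**  If `c_n > 0` and `n ↦ c_n/n` (`n ≥ 1`, passed as `m ↦ c (m+1)/(m+1)`) is completely monotone,
then the kernel `[(l + c_n)/(n−l)!]_{l ≤ n}` is totally nonnegative (THEOREM W♯(⟸) + LEMMA Q with `τ_m = m/(m + c_m)`,
`1/τ_m − 1 = c_m/m`). -/
theorem lPlusC_div_factorial_tn_of_inv_odds (c : ℕ → ℝ) (hc : ∀ n, 0 < c n)
    (hψ : ∀ k j, 0 ≤ ∑ i ∈ range (k + 1), (-1 : ℝ) ^ i * (k.choose i : ℝ) *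
      (c (j + i + 1) / ((j + i + 1 : ℕ) : ℝ)))
    {k : ℕ} (r c' : Fin k → ℕ) (hr : StrictMono r) (hc' : StrictMono c') :
    0 ≤ (Matrix.of fun i j =>
      if c' j ≤ r i then ((c' j : ℝ) + c (r i)) / ((r i - c' j)! : ℕ) else 0).det := by
  refine lPlusC_div_factorial_tn c hc (fun k j => ?_) r c' hr hc'
  have hμ : ∀ r : ℕ, ((r ! : ℕ) : ℝ) / ∏ m ∈ range r, ((m : ℝ) + 1 + c (m + 1)) =
      ∏ m ∈ range r, (((m + 1 : ℕ) : ℝ) / (((m + 1 : ℕ) : ℝ) + c (m + 1))) := by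
    intro r
    rw [prod_div_distrib, ← Nat.cast_prod, Finset.prod_range_add_one_eq_factorial]
    push_cast
    rfl
  simp only [hμ]
  refine altSum_prod_pos_of_inv (fun n => (n : ℝ) / ((n : ℝ) + c n)) (fun m => ?_) (fun m => ?_) (fun k j => ?_) k j
  · have := hc (m + 1); positivity
  · have := hc (m + 1)
    rw [div_lt_one (by positivity)]
    linarith
  · have e : ∀ n : ℕ, ((((n + 1 : ℕ) : ℝ)) / (((n + 1 : ℕ) : ℝ) + c (n + 1)))⁻¹ - 1 =
        c (n + 1) / ((n + 1 : ℕ) : ℝ) := by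
      intro n
      have h1 := hc (n + 1)
      have h2 : (0 : ℝ) < ((n + 1 : ℕ) : ℝ) := by positivity
      field_simp
      ring
    have hsum : (∑ i ∈ range (k + 1), (-1 : ℝ) ^ i * (k.choose i : ℝ) *
        (((fun n : ℕ => (n : ℝ) / ((n : ℝ) + c n)) (j + i + 1))⁻¹ - 1)) =
        ∑ i ∈ range (k + 1), (-1 : ℝ) ^ i * (k.choose i : ℝ) * (c (j + i + 1) / ((j + i + 1 : ℕ) : ℝ)) :=
      sum_congr rfl fun i _ => by rw [← e (j + i)]
    rw [hsum]
    exact hψ k j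

/-- **The whole ray.**  Under the same hypothesis (`c_n > 0`, `c_n/n` completely monotone on `n ≥ 1`), for EVERY `λ > 0` the
kernel `[(l + λ c_n)/(n−l)!]_{l ≤ n}` is totally nonnegative: the class `{c : c_n/n CM}` is a convex cone. -/
theorem lPlusC_div_factorial_tn_of_inv_odds_ray (c : ℕ → ℝ) (hc : ∀ n, 0 < c n)
    (hψ : ∀ k j, 0 ≤ ∑ i ∈ range (k + 1), (-1 : ℝ) ^ i * (k.choose i : ℝ) *
      (c (j + i + 1) / ((j + i + 1 : ℕ) : ℝ)))
    (lam : ℝ) (hlam : 0 < lam) {k : ℕ} (r c' : Fin k → ℕ) (hr : StrictMono r) (hc' : StrictMono c') :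
    0 ≤ (Matrix.of fun i j =>
      if c' j ≤ r i then ((c' j : ℝ) + lam * c (r i)) / ((r i - c' j)! : ℕ) else 0).det := by
  refine lPlusC_div_factorial_tn_of_inv_odds (fun n => lam * c n) (fun n => mul_pos hlam (hc n)) (fun k j => ?_)
    r c' hr hc'
  have e : ∀ i : ℕ, (fun n => lam * c n) (j + i + 1) / ((j + i + 1 : ℕ) : ℝ) =
      lam * (c (j + i + 1) / ((j + i + 1 : ℕ) : ℝ)) := fun i => by simp only [mul_div_assoc]
  simp_rw [e]
  rw [HypergeomCM.altSum_const_mul lam (fun n : ℕ => c (n + 1) / ((n + 1 : ℕ) : ℝ)) k j]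
  exact mul_nonneg hlam.le (by simpa using hψ k j)

end MomentRatioTN

end Summit.CriticalPhenomena.PercolationContinuityZ3.Theorems
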